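import Summits.Ventures.PercRepro.RankLevelSetCoreGeneral
import Summits.Ventures.PercRepro.RankLevelSetPlaneTenPrime
import Summits.Ventures.PercRepro.RankLevelSetLevelSixCapT
import Summits.Ventures.PercRepro.S4FlatBoundsSharp

/-!
# PercRepro — THE LARGE-CORANK REGIME WITH THE SHARP FLAT BOUNDS AND THE FLOOR `B + 2` (p4, gen 16; a feeder for S4)

night-1's THEOREM C∞ with an arbitrary flat bound (`core_all_corank_of_thresholds_of_bound`, RankLevelSetCoreGeneral)
carries the floor `2^q + 2 ≤ p` from regime II's `choose_le_midCount_of_two_pow_le` (every `(p − 1)`-subset has rank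
`> q` because a rank-`≤ q` set has `< 2^q` points). With the flat bound `B` itself the same argument needs only
`B + 1 ≤ p − 1` (`choose_le_midCount_of_flat_bound`), and the regime-I threshold `N₁` is a condition on `|E| > p + q + B + 1`,
not on `p`. Hence `core_all_corank_of_thresholds_of_flat_bound` with the floor `max P₂ (B + 2)`, instantiated with the
cover-recursion bounds `f(7) ≤ 79`, `f(8) ≤ 159`, `f(9) ≤ 319` (S4FlatBoundsSharp) and `f(6) ≤ 39`, `f(5) ≤ 19`,
`f(4) ≤ 10`, `f(j) ≤ 2^j − 1`:
* `c025_core_seven_beyond_sharp`: corank `> 87` closes at level `7` for every `p ≥ 103` (was `136`, RankLevelSetLevelSevenCapT);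
* `c025_core_eight_beyond_sharp`: corank `> 168` at level `8` for every `p ≥ 186` (was `258`);
* `c025_core_nine_beyond_sharp`: corank `> 329` at level `9` for every `p ≥ 349` (was `514`).
(Exact thresholds: `N₁(7, 79) = 127`, `N₂ = 103`; `N₁(8, 159) = 220`, `N₂ = 186`; `N₁(9, 319) = 394`, `N₂ = 349`;
`N₁ ≤ p + q + B + 2` holds from `p ≥ 39 / 50 / 64`.) Axioms: standard.
-/

set_option exponentiation.threshold 1024

open scoped Matroid

namespace PercRepro

namespace ThmN

open Set

variable {α : Type}

/-- **`C(n, p − 1) ≤ #Y(p, q)` once `B + 1 ≤ p − 1`**, `B` a bound on the size of the rank-`≤ q` sets: every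
`(p − 1)`-subset of `E` has rank `< p`, and rank `> q` since it has more than `B` points. -/
theorem choose_le_midCount_of_flat_bound (M : Matroid α) [M.Finite] {p q B : ℕ}
    (hB : ∀ X ⊆ M.E, M.eRk X ≤ q → X.ncard ≤ B) (hp : B + 1 ≤ p - 1) (hp1 : 1 ≤ p) :
    M.ground_finite.toFinset.card.choose (p - 1) ≤ Matroid.midCount M p q := by
  have hE : (M.ground_finite.toFinset : Set α) = M.E := Set.Finite.coe_toFinset _
  rw [← ncard_subsets_ncard_eq M.ground_finite.toFinset (p - 1)]
  unfold Matroid.midCount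
  apply Set.ncard_le_ncard
  · intro X hX
    have hXE : X ⊆ M.E := by rw [← hE]; exact hX.1
    have hXfin : X.Finite := M.ground_finite.subset hXE
    refine ⟨hXE, ?_, ?_⟩
    · by_contra hle
      push Not at hle
      have := hB X hXE hle
      have hc := hX.2
      omega
    · calc M.eRk X ≤ X.encard := M.eRk_le_encard X
        _ = ((p - 1 : ℕ) : ℕ∞) := by rw [← hXfin.cast_ncard_eq, hX.2]
        _ < (p : ℕ∞) := by exact_mod_cast (show p - 1 < p by omega)
  · exact M.ground_finite.finite_subsets.subset (fun X hX => hX.1)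

/-- **THEOREM C∞ on the core with an arbitrary flat bound, the floor `B + 2` in place of `2^q + 2`** (night-1's
`core_all_corank_of_thresholds_of_bound` with `choose_le_midCount_of_flat_bound` in regime II and the regime-I threshold
`N₁` read on `|E|`, which exceeds `p + q + B + 1`): every finite matroid of rank `p ≥ max P₂ (B + 2)` with
`N₁ ≤ p + q + B + 2`, `|E| > p + q + B + 1`, the `e`-free partitions and the flat bounds `|X| + q ≤ B + j` for
`r(X) ≤ j ≤ q` satisfies `RLS M p q`. -/
theorem core_all_corank_of_thresholds_of_flat_bound (q B : ℕ) (hq : 2 ≤ q) (hqB : q ≤ B) (N₁ P₂ : ℕ)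
    (hN₁ : ∀ n, N₁ ≤ n → 8 * (q + 1) * 2 ^ (B - q) * n ^ q ≤ 2 ^ n)
    (hP₂ : ∀ p, P₂ ≤ p → 2 ^ (p + q) * 2 ^ (B - q) * (2 * (p - 1 - q) + 1) ≤ 4 ^ (p - 1 - q)) :
    ∀ {α : Type} (M : Matroid α) [M.Finite] (p : ℕ), max P₂ (B + 2) ≤ p → N₁ ≤ p + q + B + 2 → M.eRank = (p : ℕ∞) →
      p + q + B + 1 < M.E.ncard →
      (∀ e ∈ M.E, ∃ A ⊆ M.E \ {e}, e ∉ M.closure A ∧ e ∉ M.closure ((M.E \ {e}) \ A)) →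
      (∀ j, j ≤ q → ∀ X ⊆ M.E, M.eRk X ≤ j → X.ncard + q ≤ B + j) → RLS M p q := by
  classical
  intro α M _ p hP hN₁p' hR hbig hfree hBj
  set n := M.E.ncard with hn_def
  have hEcard : M.ground_finite.toFinset.card = n := by
    rw [hn_def, Set.ncard_eq_toFinset_card _ M.ground_finite]
  have hpP : B + 2 ≤ p := le_trans (le_max_right _ _) hP
  have hP₂p : P₂ ≤ p := le_trans (le_max_left _ _) hP
  have hpn : p ≤ n := by omega
  have hBq' : ∀ X ⊆ M.E, M.eRk X ≤ q → X.ncard ≤ B := fun X hX hr => by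
    have := hBj q le_rfl X hX hr; omega
  have hU : Matroid.topCount M p q ≤ n.choose q * 2 ^ (B - q) := by
    calc Matroid.topCount M p q ≤ Matroid.levelCount M q := Matroid.topCount_le_levelCount_bot p q
      _ = {X : Set α | X ⊆ M.E ∧ M.eRk X = q}.ncard := rfl
      _ ≤ n.choose q * 2 ^ (B - q) := by rw [← hEcard]; exact ncard_eRk_eq_le_choose_mul_of_bound M q B hBq'
  have hΦ := phiK_le_two_pow_div p q
  have hU0 : (0 : ℚ) ≤ (Matroid.topCount M p q : ℚ) := by positivity
  have hUq : (Matroid.topCount M p q : ℚ) ≤ (n.choose q : ℚ) * 2 ^ (B - q) := by exact_mod_cast hU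
  rw [RLS_iff]
  rcases Nat.lt_or_ge n (2 * p) with hsmall | hlarge
  · have hd : M.E.encard = M.eRank + ((n - p : ℕ) : ℕ∞) := by
      rw [hR, ← M.ground_finite.cast_ncard_eq]
      norm_cast
      omega
    have hY := Matroid.two_pow_le_midCount_add (M := M) p q hR
    have hA := ncard_eRk_le_le_sum_choose_mul_of_bound M q B hBj
    have hB := Matroid.ncard_spanning_le (M := M) hd
    rw [hEcard] at hY hA hB
    have hA' : (∑ j ∈ Finset.range (q + 1), n.choose j) * 2 ^ (B - q) ≤ 2 ^ (n - 3) := by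
      have h1 := sum_choose_le_mul_pow n q (by omega)
      have h2 := hN₁ n (by omega)
      have h3 : 2 ^ n = 2 ^ (n - 3) * 8 := by
        rw [show (8 : ℕ) = 2 ^ 3 by norm_num, ← pow_add]; congr 1; omega
      have h5 : 8 * ((∑ j ∈ Finset.range (q + 1), n.choose j) * 2 ^ (B - q)) ≤ 8 * 2 ^ (n - 3) := by
        calc 8 * ((∑ j ∈ Finset.range (q + 1), n.choose j) * 2 ^ (B - q))
            ≤ 8 * (((q + 1) * n ^ q) * 2 ^ (B - q)) := by gcongr
          _ = 8 * (q + 1) * 2 ^ (B - q) * n ^ q := by ring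
          _ ≤ 2 ^ n := h2
          _ = 8 * 2 ^ (n - 3) := by rw [h3]; ring
      exact Nat.le_of_mul_le_mul_left h5 (by norm_num)
    have hB' : ∑ j ∈ Finset.range (n - p + 1), n.choose j ≤ 2 ^ (n - 1) :=
      sum_choose_le_two_pow_pred n (n - p) (by omega)
    have hCn : n.choose q ≤ 2 ^ q * (p + q).choose p := by
      rw [Nat.choose_symm_add]
      exact choose_le_two_pow_mul_choose n p q (by omega)
    have hYq : (2 : ℚ) ^ n ≤ (Matroid.midCount M p q : ℚ) + ({X : Set α | X ⊆ M.E ∧ M.eRk X ≤ q}.ncard : ℚ) +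
        ({X : Set α | X ⊆ M.E ∧ M.eRk X = M.eRank}.ncard : ℚ) := by exact_mod_cast hY
    have hAq : ({X : Set α | X ⊆ M.E ∧ M.eRk X ≤ q}.ncard : ℚ) ≤ 2 ^ (n - 3) := by
      exact_mod_cast hA.trans hA'
    have hBq2 : ({X : Set α | X ⊆ M.E ∧ M.eRk X = M.eRank}.ncard : ℚ) ≤ 2 ^ (n - 1) := by
      exact_mod_cast hB.trans hB'
    have hCnq : (n.choose q : ℚ) ≤ 2 ^ q * ((p + q).choose p : ℚ) := by exact_mod_cast hCn
    have hk : p + 2 * q + (B - q) + 2 ≤ n := by omega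
    exact coreSharper_arith_I hq hk hΦ hU0 hUq hCnq hYq hAq hBq2
  · have hY := choose_le_midCount_of_flat_bound M hBq' (p := p) (by omega) (by omega)
    rw [hEcard] at hY
    have hkey := choose_mul_le_choose_mul_of_threshold n p q (2 ^ (B - q)) (by omega) hlarge (hP₂ p hP₂p)
    have hYq : (n.choose (p - 1) : ℚ) ≤ (Matroid.midCount M p q : ℚ) := by exact_mod_cast hY
    have hUq' : (Matroid.topCount M p q : ℚ) ≤ (n.choose q : ℚ) * ((2 ^ (B - q) : ℕ) : ℚ) := by
      exact_mod_cast hU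
    exact coreSharp_arith_II hΦ hU0 hUq' hkey hYq


/-- The flat bounds of the `e`-free core at `q = 7` with `B = 79`: `|X| + 7 ≤ 79 + j` for `r(X) ≤ j ≤ 7`
(`f(7) ≤ 79`, `f(6) ≤ 39`, `f(5) ≤ 19`, `f(4) ≤ 10`, `f(j) ≤ 2^j − 1` below). -/
theorem flat_bounds_seven_sharp_of_free (M : Matroid α) [M.Finite]
    (hfree : ∀ e ∈ M.E, ∃ A ⊆ M.E \ {e}, e ∉ M.closure A ∧ e ∉ M.closure ((M.E \ {e}) \ A)) :
    ∀ j : ℕ, j ≤ 7 → ∀ X ⊆ M.E, M.eRk X ≤ j → X.ncard + 7 ≤ 79 + j := by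
  intro j hj X hX hr
  rcases Nat.lt_or_ge j 7 with h | h
  · have := ncard_add_one_le_two_pow_of_eRk_le M (not_isLoop_of_free M hfree) hfree j X hX hr
    interval_cases j <;> omega
  · have hj7 : j = 7 := by omega
    subst hj7
    have := ncard_le_seventynine_of_eRk_le_seven_of_free M hfree X hX hr
    omega

/-- The flat bounds at `q = 8` with `B = 159`. -/
theorem flat_bounds_eight_sharp_of_free (M : Matroid α) [M.Finite]
    (hfree : ∀ e ∈ M.E, ∃ A ⊆ M.E \ {e}, e ∉ M.closure A ∧ e ∉ M.closure ((M.E \ {e}) \ A)) :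
    ∀ j : ℕ, j ≤ 8 → ∀ X ⊆ M.E, M.eRk X ≤ j → X.ncard + 8 ≤ 159 + j := by
  intro j hj X hX hr
  rcases Nat.lt_or_ge j 8 with h | h
  · have := ncard_add_one_le_two_pow_of_eRk_le M (not_isLoop_of_free M hfree) hfree j X hX hr
    interval_cases j <;> omega
  · have hj8 : j = 8 := by omega
    subst hj8
    have := ncard_le_one_fifty_nine_of_eRk_le_eight_of_free M hfree X hX hr
    omega

/-- The flat bounds at `q = 9` with `B = 319`. -/
theorem flat_bounds_nine_sharp_of_free (M : Matroid α) [M.Finite]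
    (hfree : ∀ e ∈ M.E, ∃ A ⊆ M.E \ {e}, e ∉ M.closure A ∧ e ∉ M.closure ((M.E \ {e}) \ A)) :
    ∀ j : ℕ, j ≤ 9 → ∀ X ⊆ M.E, M.eRk X ≤ j → X.ncard + 9 ≤ 319 + j := by
  intro j hj X hX hr
  rcases Nat.lt_or_ge j 9 with h | h
  · have := ncard_add_one_le_two_pow_of_eRk_le M (not_isLoop_of_free M hfree) hfree j X hX hr
    interval_cases j <;> omega
  · have hj9 : j = 9 := by omega
    subst hj9
    have := ncard_le_three_nineteen_of_eRk_le_nine_of_free M hfree X hX hr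
    omega

/-- **The `e`-free core at level `7`, corank `> 87`, rank `p ≥ 103`** (regime thresholds `N₁ = 127` on `|E|`,
`N₂ = 103`; floor `B + 2 = 81`). -/
theorem c025_core_seven_beyond_sharp (M : Matroid α) [M.Finite] (p : ℕ) (hp : 103 ≤ p)
    (hR : M.eRank = (p : ℕ∞)) (hbig : p + 87 < M.E.ncard)
    (hfree : ∀ e ∈ M.E, ∃ A ⊆ M.E \ {e}, e ∉ M.closure A ∧ e ∉ M.closure ((M.E \ {e}) \ A)) : RLS M p 7 := by
  have hN₁ : ∀ n, 127 ≤ n → 8 * (7 + 1) * 2 ^ (79 - 7) * n ^ 7 ≤ 2 ^ n :=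
    mul_pow_le_two_pow_of_base (8 * (7 + 1) * 2 ^ (79 - 7)) 7 127 (by norm_num) (by norm_num) (by norm_num)
  have hP₂ := threshold_II_of_base 7 (2 ^ (79 - 7)) 103 (by norm_num) (by norm_num)
  exact core_all_corank_of_thresholds_of_flat_bound 7 79 (by norm_num) (by norm_num) 127 103 hN₁ hP₂ M p
    (by rw [show max 103 (79 + 2) = 103 from rfl]; exact hp) (by omega) hR (by omega) hfree
    (flat_bounds_seven_sharp_of_free M hfree)

/-- **The `e`-free core at level `8`, corank `> 168`, rank `p ≥ 186`** (`N₁ = 220` on `|E|`, `N₂ = 186`; floor `161`). -/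
theorem c025_core_eight_beyond_sharp (M : Matroid α) [M.Finite] (p : ℕ) (hp : 186 ≤ p)
    (hR : M.eRank = (p : ℕ∞)) (hbig : p + 168 < M.E.ncard)
    (hfree : ∀ e ∈ M.E, ∃ A ⊆ M.E \ {e}, e ∉ M.closure A ∧ e ∉ M.closure ((M.E \ {e}) \ A)) : RLS M p 8 := by
  have hN₁ : ∀ n, 220 ≤ n → 8 * (8 + 1) * 2 ^ (159 - 8) * n ^ 8 ≤ 2 ^ n :=
    mul_pow_le_two_pow_of_base (8 * (8 + 1) * 2 ^ (159 - 8)) 8 220 (by norm_num) (by norm_num) (by norm_num)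
  have hP₂ := threshold_II_of_base 8 (2 ^ (159 - 8)) 186 (by norm_num) (by norm_num)
  exact core_all_corank_of_thresholds_of_flat_bound 8 159 (by norm_num) (by norm_num) 220 186 hN₁ hP₂ M p
    (by rw [show max 186 (159 + 2) = 186 from rfl]; exact hp) (by omega) hR (by omega) hfree
    (flat_bounds_eight_sharp_of_free M hfree)

/-- **The `e`-free core at level `9`, corank `> 329`, rank `p ≥ 349`** (`N₁ = 394` on `|E|`, `N₂ = 349`; floor `321`). -/
theorem c025_core_nine_beyond_sharp (M : Matroid α) [M.Finite] (p : ℕ) (hp : 349 ≤ p)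
    (hR : M.eRank = (p : ℕ∞)) (hbig : p + 329 < M.E.ncard)
    (hfree : ∀ e ∈ M.E, ∃ A ⊆ M.E \ {e}, e ∉ M.closure A ∧ e ∉ M.closure ((M.E \ {e}) \ A)) : RLS M p 9 := by
  have hN₁ : ∀ n, 394 ≤ n → 8 * (9 + 1) * 2 ^ (319 - 9) * n ^ 9 ≤ 2 ^ n :=
    mul_pow_le_two_pow_of_base (8 * (9 + 1) * 2 ^ (319 - 9)) 9 394 (by norm_num) (by norm_num) (by norm_num)
  have hP₂ := threshold_II_of_base 9 (2 ^ (319 - 9)) 349 (by norm_num) (by norm_num)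
  exact core_all_corank_of_thresholds_of_flat_bound 9 319 (by norm_num) (by norm_num) 394 349 hN₁ hP₂ M p
    (by rw [show max 349 (319 + 2) = 349 from rfl]; exact hp) (by omega) hR (by omega) hfree
    (flat_bounds_nine_sharp_of_free M hfree)

end ThmN

end PercRepro
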